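import Literature.Computability.AlgebraicComplexity.LMR13PLambdaStabilizerAssembly
import Literature.Computability.AlgebraicComplexity.LMR13PLambdaStabilizerBlockIVanishing
import Literature.Computability.AlgebraicComplexity.LMR13PLambdaStabilizerBlockIII
import HarnessLib

/-!
# LMR 2013 Prop. 3.5.1 HOLDS (assembly of the (X3b) blocks)

[topic Computability/AlgebraicComplexity]

Landsberg–Manivel–Ressayre 2013, Prop. 3.5.1 (p. 481): `P_Λ ∈ Δ(det_n)`, `Δ(P_Λ)` is an irreducible
codimension-one component of the boundary of `Δ(det_n)`, not contained in `End(W)·det_n`, and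
`\overline{dc}(P_Λ) = n < dc(P_Λ)` (odd `n ≥ 3`) — the named fact `LMR2013_prop_3_5_1`
(`LMR13DualVarieties.lean`, val-lit-t11) DISCHARGED BY NAME: `SkewAdj.LMR2013_prop_3_5_1_of_blocks`
(val-lit-p7, `LMR13PLambdaStabilizerAssembly.lean`: the `2n² − 1` functionals and
`LMR2013_prop_3_5_1_of_finrank_glAnn_le`, val-lit-t11; `n = 3` by `finrank_glAnn_pLambda_three`, val-lit-p8)
applied to the block theorems (I) `SkewAdj.pLambda_blockI` (val-lit-t13, `LMR13PLambdaStabilizerBlockIVanishing.lean`)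
and (III) `SkewAdj.skewPart_linAct_skew_eq_zero` (val-lit-t12, `LMR13PLambdaStabilizerBlockIII.lean`) of the
elementary stabiliser count `dim 𝔤𝔩(W)_{P_Λ} ≤ 2n² − 1` (cell route memo, val-lit-t10; the printed proof
instead reads the `GL_n`-module structure of `End(Λ² ⊕ S²)` — route deviation disclosed in the block files).
Honest framing: literature discharge of a published proposition; VP ≠ VNP is NOT proved and nothing here is
progress on it.

## References

* [LandsbergManivelRessayre2013] J. M. Landsberg, L. Manivel, N. Ressayre, *Hypersurfaces with degenerate duals
  and the geometric complexity theory program*, Comment. Math. Helv. 88 (2013) 469–484, Proposition 3.5.1 (p. 481).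
* [HuttenhainLairez2016] J. Hüttenhain, P. Lairez, *The boundary of the orbit of the 3 by 3 determinant
  polynomial*, C. R. Math. 354 (2016), Lemma 5 (the case `n = 3`).
-/

namespace Literature.Computability.AlgebraicComplexity

/-- **LMR 2013, Prop. 3.5.1 — the named fact HOLDS** (all odd `n ≥ 3`): assembly
`SkewAdj.LMR2013_prop_3_5_1_of_blocks` of block (I) `SkewAdj.pLambda_blockI` and block (III)
`SkewAdj.skewPart_linAct_skew_eq_zero`. [cite: LandsbergManivelRessayre2013, Proposition 3.5.1 (p. 481)] -/
theorem LMR2013_prop_3_5_1_holds : LMR2013_prop_3_5_1 :=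
  SkewAdj.LMR2013_prop_3_5_1_of_blocks SkewAdj.pLambda_blockI
    (fun _ hh _ hX hΦ hΨ hΨ12 _ hA => SkewAdj.skewPart_linAct_skew_eq_zero hh hX hΦ hΨ hΨ12 hA)

end Literature.Computability.AlgebraicComplexity
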